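/-
Copyright (c) 2026 the pub-hodgecm-mathlib formalisation cell (harness21).  Prover seat hodgecm-mathlib-K2E3-p11 (g5), Track B «K2-LIT» ∕ h413
(`stmt-HodgeConjecture-24833`), line `K2_E3_EllipticInputs`, road «GL-[M6]-sc» brick T15-log: THE MIXED HALF — `1[disc χ_X ≠ 0 ∧ χ_X has exactly one root in F] ·
‖disc χ_X‖_F^{-(1∕2+ε)}` IS LOCALLY INTEGRABLE ON `𝔤𝔩₃(F)` (Harish-Chandra's Theorem 15 for the mixed Cartan `E× × F×`, on the Lie algebra).  2026-09-04.
-/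
import Summits.HodgeConjecture.HodgeConjecture.Theorems.K2E3GL3ParabolicSliceRpowNegKit   -- ★ M3a (this seat): slice algebra, rearrangement, peeling on `(𝔭ⁿ)⁷`
import Summits.HodgeConjecture.HodgeConjecture.Theorems.K2E3GL3ParabolicSliceDensity      -- ★ (3E) leaf p858128 (this seat): brings ★ H″6 `…DensityAE`, ★ H″4 `…CharpolyDiscNull`, the twin's box lemma, `coe_multiset_sum_map`
import Mathlib.Analysis.MeanInequalities                                                  -- `ENNReal.young_inequality`
import HarnessLib

/-!
# K2_E3 road (h413), «GL-[M6]-sc» brick T15-log — THE MIXED HALF of Harish-Chandra's Theorem 15 on `𝔤𝔩₃(F)`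

Cell `pub/hodgecm-mathlib` (D-0151), Track B, seat K2E3-p11 (g5) (T15-log MIXED HALF, `K2/STATUS.md` 2026-09-04 07:18:47Z; road owner K2E3-p23 (g5) RULINGS #14
«=»; the SPLIT half is ★ K2E3-p17 (g7) `K2E3GL3SplitDiscriminantLocIntegrable`).  `--supports stmt-HodgeConjecture-24833 --as helper`; THEOREMS ONLY (no definition ∕
instance ∕ notation ∕ named fact ∕ `sorry`); never imports `Cruxes/…/Lines`.  COUNT-NEUTRAL.

THE RESULT.  For every compact `S ⊂ 𝔤𝔩₃(F)` (`2 ≠ 0` in `F`), every additive Haar `μ𝔤` and every `0 < ε < 1∕8`: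
  `∫⁻_S 1[disc χ_X ≠ 0 ∧ #roots_F χ_X = 1] · ‖disc χ_X‖^{-(1∕2+ε)} dμ𝔤 < ∞`
(**`setLIntegral_indicator_mixed_rpow_neg_lt_top`**), and the `LocallyIntegrable` (real-valued) form **`locallyIntegrable_indicator_mixed_rpow_neg`** — same shape as
the split half.  PROOF (the parabolic slice, NOT a torus): on the mixed set `χ_X = (X − a)·q` with `q` irreducible, `‖disc χ_X‖ = ‖q(a)‖²‖disc q‖`, and ★ (3E)'s
density is `w(X) ≥ C‖χ_X'(a)‖⁻¹ = C‖q(a)‖⁻¹` for every rational root `a`; so by ★ H″6 `exists_lintegral_parabolicSlice_eq_lintegral_mul_density` (valid for ALL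
measurable `h ≥ 0`) with `h = 1_S 1_{mixed} w⁻¹ ‖disc‖^{-(1∕2+ε)}`, the integral equals `∫_K∫_{F⁷} h(Ad(k)P(r)) dr dk`, and for `r` in the box `P⁻¹(Ad(K)⁻¹S) ⊆ (𝔭^{-m})⁷`
the integrand is `≤ C⁻¹ ‖χ_A(r₆)‖^{-2ε} ‖disc χ_A‖^{-(1∕2+ε)} ≤ C⁻¹ (‖(r₀−r₄)² + 4r₃r₁‖^{-(2∕3+4ε∕3)} + ‖(r₆−r₀)(r₆−r₄) − r₃r₁‖^{-8ε})` (Young `4∕3, 4`), each of which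
is AFFINE IN `r₁` with slope `4r₃` resp. `−r₃` — ★ M3a's peeling (`∫_{𝔭ⁿ}‖c + λy‖^{-s} ≤ ‖λ‖^{-s}∫_{𝔭ⁿ}‖y‖^{-s}`, then `∫‖r₃‖^{-s} < ∞`, `s < 1`).  No field extension,
no torus, no Weyl integration: the elliptic `𝔤𝔩₂`-block is never diagonalised.
[HarishChandra1970, Part VII §3 Thm. 15 p. 72, Part V §6] [HarishChandra1999AdmissibleDistributions, §7 Lemma 7.9, §15] [Tate1950, §2.4]
HONEST LABEL: HC_CM is proved only modulo the 7 printed citations (2 remaining named inputs: hLiu418 = stmt-HodgeConjecture-24832, h413 =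
stmt-HodgeConjecture-24833) until rung 0 closes; count-neutral helper (feeds ASM of `sig_K2E3GL3ModUniformizerNonEllEstimates` via K2E3-p17's transports).

## References
* [HarishChandra1970] Harish-Chandra (van Dijk), *Harmonic Analysis on Reductive p-adic Groups*, LNM 162 (1970), Part V §6, Part VII §3 Thm. 15.
* [HarishChandra1999AdmissibleDistributions] Harish-Chandra (DeBacker–Sally), *Admissible Invariant Distributions on Reductive p-adic Groups* (1999), §7, §15.
* [Tate1950] J. Tate, *Fourier analysis in number fields and Hecke's zeta-functions* (1950), §2.4.
-/

set_option autoImplicit false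
set_option linter.dupNamespace false

noncomputable section

open MeasureTheory Measure Filter Topology Set Matrix Polynomial
open scoped MatrixGroups NNReal ENNReal
open Literature.NumberTheory.Automorphic Literature.NumberTheory.Automorphic.LocalFieldHaar
open Literature.NumberTheory.GaloisRepresentations Literature.NumberTheory.GaloisRepresentations.IsNonarchimedeanLocalField
open Summit.HodgeConjecture.HodgeConjecture.Cruxes.H413.K2E3GL3ParabolicSliceRpowNegKit
open Summit.HodgeConjecture.HodgeConjecture.Cruxes.H413.K2E3CubicRationalRootsLocallyConstant

namespace Summit.HodgeConjecture.HodgeConjecture.Cruxes.H413.K2E3GL3MixedDiscriminantLocIntegrable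

variable {F : Type*} [Field F] [ValuativeRel F] [TopologicalSpace F] [IsNonarchimedeanLocalField F]

/-! ## §1  Two small tools -/

/-- Young with exponents `(4∕3, 4)`, constants dropped: `f·g ≤ f^{4∕3} + g⁴` in `ℝ≥0∞`. [folklore] -/
theorem mul_le_rpow_add_rpow (f g : ℝ≥0∞) : f * g ≤ f ^ (4 / 3 : ℝ) + g ^ (4 : ℝ) := by
  have hpq : (4 / 3 : ℝ).HolderConjugate 4 := by rw [Real.holderConjugate_iff]; norm_num
  refine (ENNReal.young_inequality f g hpq).trans (add_le_add ?_ ?_)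
  · exact ENNReal.div_le_of_le_mul (le_mul_of_one_le_right zero_le (ENNReal.one_le_ofReal.2 (by norm_num)))
  · exact ENNReal.div_le_of_le_mul (le_mul_of_one_le_right zero_le (ENNReal.one_le_ofReal.2 (by norm_num)))

/-- **The box**: a compact `S ⊂ 𝔤𝔩₃(F)` is reached by the parabolic slice only from a bounded box, uniformly over `K = GL₃(𝒪)`:
`Ad(k)P(r) ∈ S ⇒ r ∈ (𝔭^{-m})⁷` (the twin ★ `exists_forall_mem_primePowBall_of_isCompact` on the compact `Ad(K)⁻¹S`). [cite: WeilBNT1967, Ch. II n° 27] -/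
theorem exists_forall_conj_parabolic_mem_imp {S : Set (Matrix (Fin 3) (Fin 3) F)} (hS : IsCompact S) :
    ∃ m : ℕ, ∀ (k : ↥(glInt 3 F)) (r : Fin 7 → F),
      ((k : GL (Fin 3) F) : Matrix (Fin 3) (Fin 3) F) * !![r 0, r 1, r 2; r 3, r 4, r 5; 0, 0, r 6] *
          ((((k : GL (Fin 3) F))⁻¹ : GL (Fin 3) F) : Matrix (Fin 3) (Fin 3) F) ∈ S →
        ∀ i, r i ∈ primePowBall F (-(m : ℤ)) := by
  haveI : T2Space F := (isLocalField F).toT2Space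
  haveI : IsTopologicalRing F := inferInstance
  have hSK : IsCompact ((fun p : ↥(glInt 3 F) × Matrix (Fin 3) (Fin 3) F =>
      ((((p.1 : GL (Fin 3) F))⁻¹ : GL (Fin 3) F) : Matrix (Fin 3) (Fin 3) F) * p.2 * ((p.1 : GL (Fin 3) F) : Matrix (Fin 3) (Fin 3) F)) '' (univ ×ˢ S)) :=
    ((isCompact_iff_isCompact_univ.1 (isCompact_glInt (n := 3) (F := F))).prod hS).image
      ((((Units.continuous_coe_inv.comp (continuous_subtype_val.comp continuous_fst))).mul continuous_snd).mul
        (Units.continuous_val.comp (continuous_subtype_val.comp continuous_fst)))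
  obtain ⟨m, hm⟩ := K2E3GL3BorelSliceDensity.exists_forall_mem_primePowBall_of_isCompact hSK
  refine ⟨m, fun k r hkr => ?_⟩
  have hb : (!![r 0, r 1, r 2; r 3, r 4, r 5; 0, 0, r 6] : Matrix (Fin 3) (Fin 3) F) ∈ (fun p : ↥(glInt 3 F) × Matrix (Fin 3) (Fin 3) F =>
      ((((p.1 : GL (Fin 3) F))⁻¹ : GL (Fin 3) F) : Matrix (Fin 3) (Fin 3) F) * p.2 * ((p.1 : GL (Fin 3) F) : Matrix (Fin 3) (Fin 3) F)) '' (univ ×ˢ S) := by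
    refine ⟨(k, ((k : GL (Fin 3) F) : Matrix (Fin 3) (Fin 3) F) * !![r 0, r 1, r 2; r 3, r 4, r 5; 0, 0, r 6] *
      ((((k : GL (Fin 3) F))⁻¹ : GL (Fin 3) F) : Matrix (Fin 3) (Fin 3) F)), ⟨Set.mem_univ _, hkr⟩, ?_⟩
    simp only
    rw [show ((((k : GL (Fin 3) F))⁻¹ : GL (Fin 3) F) : Matrix (Fin 3) (Fin 3) F) * (((k : GL (Fin 3) F) : Matrix (Fin 3) (Fin 3) F) *
        !![r 0, r 1, r 2; r 3, r 4, r 5; 0, 0, r 6] * ((((k : GL (Fin 3) F))⁻¹ : GL (Fin 3) F) : Matrix (Fin 3) (Fin 3) F)) * ((k : GL (Fin 3) F) : Matrix (Fin 3) (Fin 3) F)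
        = (((((k : GL (Fin 3) F))⁻¹ : GL (Fin 3) F) : Matrix (Fin 3) (Fin 3) F) * ((k : GL (Fin 3) F) : Matrix (Fin 3) (Fin 3) F)) * !![r 0, r 1, r 2; r 3, r 4, r 5; 0, 0, r 6] *
        (((((k : GL (Fin 3) F))⁻¹ : GL (Fin 3) F) : Matrix (Fin 3) (Fin 3) F) * ((k : GL (Fin 3) F) : Matrix (Fin 3) (Fin 3) F)) by simp only [Matrix.mul_assoc],
      Units.inv_mul, Matrix.one_mul, Matrix.mul_one]
  have he := hm _ hb
  intro i
  fin_cases i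
  · exact he 0 0
  · exact he 0 1
  · exact he 0 2
  · exact he 1 0
  · exact he 1 1
  · exact he 1 2
  · exact he 2 2

/-! ## §2  The mixed half -/

section Main

variable [MeasurableSpace (Matrix (Fin 3) (Fin 3) F)] [BorelSpace (Matrix (Fin 3) (Fin 3) F)]

set_option maxHeartbeats 1600000 in
/-- **T15-log, MIXED HALF (`ℝ≥0∞` form on compacta): `∫⁻_S 1[disc χ_X ≠ 0 ∧ #roots_F χ_X = 1] · ‖disc χ_X‖^{-(1∕2+ε)} dμ𝔤 < ∞`** for `S` compact, `0 < ε < 1∕8`,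
`2 ≠ 0` in `F` (see the module docstring for the proof through ★ (3E)). [cite: HarishChandra1970, Part VII §3 Thm. 15 p. 72] [cite: HarishChandra1999AdmissibleDistributions, §7 Lemma 7.9] -/
theorem setLIntegral_indicator_mixed_rpow_neg_lt_top (h2 : (2 : F) ≠ 0) (μ𝔤 : Measure (Matrix (Fin 3) (Fin 3) F)) [μ𝔤.IsAddHaarMeasure]
    {S : Set (Matrix (Fin 3) (Fin 3) F)} (hS : IsCompact S) {ε : ℝ} (hε0 : 0 < ε) (hε : ε < 1 / 8) :
    ∫⁻ X in S, {Y : Matrix (Fin 3) (Fin 3) F | Y.charpoly.discr ≠ 0 ∧ Y.charpoly.roots.card = 1}.indicator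
        (fun Y => ((normAbs F Y.charpoly.discr : ℝ≥0∞)) ^ (-(1 / 2 + ε))) X ∂μ𝔤 < ∞ := by
  classical
  haveI : T2Space F := (isLocalField F).toT2Space
  haveI : LocallyCompactSpace F := (isLocalField F).toLocallyCompactSpace
  haveI : SecondCountableTopology F := secondCountableTopology_localField F
  haveI : IsTopologicalRing F := inferInstance
  letI : MeasurableSpace F := borel F
  haveI : BorelSpace F := ⟨rfl⟩
  letI : MeasurableSpace (GL (Fin 3) F) := borel (GL (Fin 3) F)
  haveI : BorelSpace (GL (Fin 3) F) := ⟨rfl⟩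
  haveI : T2Space (GL (Fin 3) F) := t2Space_generalLinearGroup F 3
  haveI : T2Space (Matrix (Fin 3) (Fin 3) F) := inferInstanceAs (T2Space (Fin 3 → Fin 3 → F))
  haveI : SecondCountableTopology (Matrix (Fin 3) (Fin 3) F) := inferInstanceAs (SecondCountableTopology (Fin 3 → Fin 3 → F))
  haveI : SecondCountableTopology (Matrix (Fin 3) (Fin 3) F)ᵐᵒᵖ := MulOpposite.opHomeomorph.symm.secondCountableTopology
  haveI : SecondCountableTopology (GL (Fin 3) F) := Units.isEmbedding_embedProduct.secondCountableTopology
  haveI : SecondCountableTopology ↥(glInt 3 F) := TopologicalSpace.Subtype.secondCountableTopology _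
  haveI : BorelSpace ↥(glInt 3 F) := Subtype.borelSpace _
  haveI : CompactSpace ↥(glInt 3 F) := isCompact_iff_compactSpace.1 (isCompact_glInt (n := 3) (F := F))
  haveI : LocallyCompactSpace (GL (Fin 3) F) := locallyCompactSpace_generalLinearGroup F 3
  haveI : LocallyCompactSpace ↥(glInt 3 F) := (isOpen_glInt 3 F).isOpenEmbedding_subtypeVal.locallyCompactSpace
  set κ : Measure ↥(glInt 3 F) := Measure.haar with hκ
  haveI : IsFiniteMeasure κ := CompactSpace.isFiniteMeasure
  set dx : Measure F := Measure.addHaar with hdx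
  haveI : SFinite dx := inferInstance
  -- ★ (3E) in its `ℝ≥0∞` form (★ H″6 over ★ H″4)
  obtain ⟨C, hC0, hCt, hId⟩ := K2E3GL3ParabolicSliceDensityAE.exists_lintegral_parabolicSlice_eq_lintegral_mul_density (F := F) κ dx μ𝔤
    (K2E3GL3CharpolyDiscNull.pi_setOf_discr_charpoly_parabolic_eq_zero (F := F) dx)
  -- abbreviations
  set σ : ℝ := 1 / 2 + ε with hσ
  set s₁ : ℝ := (1 / 2 + ε) * (4 / 3) with hs₁
  set s₂ : ℝ := 2 * ε * 4 with hs₂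
  have hs₁0 : 0 < s₁ := by rw [hs₁]; positivity
  have hs₁1 : s₁ < 1 := by rw [hs₁]; linarith
  have hs₂0 : 0 < s₂ := by rw [hs₂]; positivity
  have hs₂1 : s₂ < 1 := by rw [hs₂]; linarith
  set Mx : Set (Matrix (Fin 3) (Fin 3) F) := {Y : Matrix (Fin 3) (Fin 3) F | Y.charpoly.discr ≠ 0 ∧ Y.charpoly.roots.card = 1} with hMx
  have hMxm : MeasurableSet Mx := (isOpen_setOf_charpoly_discr_ne_zero_and_card_roots_eq 1).measurableSet
  have hdiscm : Measurable fun Y : Matrix (Fin 3) (Fin 3) F => Y.charpoly.discr := (F0P3cStCharTSHCDGroupToLie.continuous_discr_charpoly (K := F)).measurable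
  have hnd : Measurable fun Y : Matrix (Fin 3) (Fin 3) F => ((normAbs F Y.charpoly.discr : ℝ≥0∞)) := (measurable_normAbs.comp hdiscm).coe_nnreal_ennreal
  have hSm : MeasurableSet S := hS.isClosed.measurableSet
  -- the density of ★ (3E)
  set wE : Matrix (Fin 3) (Fin 3) F → ℝ≥0∞ := fun X => ({X : Matrix (Fin 3) (Fin 3) F | X.charpoly.discr ≠ 0}).indicator
    (fun X => C * (X.charpoly.roots.map fun a => (((normAbs F (X.charpoly.derivative.eval a))⁻¹ : ℝ≥0) : ℝ≥0∞)).sum) X with hwE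
  have hwEm : Measurable wE := K2E3GL3ParabolicSliceDensityAE.measurable_density (F := F) C
  -- lower bound of the density at a rational root, and finiteness
  have hwE_ge : ∀ (X : Matrix (Fin 3) (Fin 3) F) (a : F), X.charpoly.discr ≠ 0 → a ∈ X.charpoly.roots →
      C * (((normAbs F (X.charpoly.derivative.eval a))⁻¹ : ℝ≥0) : ℝ≥0∞) ≤ wE X := by
    intro X a hD ha
    rw [hwE]
    dsimp only
    rw [indicator_of_mem (show X ∈ {X : Matrix (Fin 3) (Fin 3) F | X.charpoly.discr ≠ 0} from hD)]
    have hmem : (((normAbs F (X.charpoly.derivative.eval a))⁻¹ : ℝ≥0) : ℝ≥0∞) ∈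
        X.charpoly.roots.map (fun a => (((normAbs F (X.charpoly.derivative.eval a))⁻¹ : ℝ≥0) : ℝ≥0∞)) := Multiset.mem_map.2 ⟨a, ha, rfl⟩
    exact mul_le_mul' le_rfl (Multiset.le_sum_of_mem hmem)
  have hwE_top : ∀ X : Matrix (Fin 3) (Fin 3) F, wE X ≠ ⊤ := by
    intro X
    rw [hwE]
    dsimp only
    by_cases hX : X ∈ {X : Matrix (Fin 3) (Fin 3) F | X.charpoly.discr ≠ 0}
    · rw [indicator_of_mem hX, ← K2E3GL3ParabolicSliceDensity.coe_multiset_sum_map]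
      exact ENNReal.mul_ne_top hCt ENNReal.coe_ne_top
    · rw [indicator_of_notMem hX]; exact ENNReal.zero_ne_top
  have hwE_ne : ∀ X ∈ Mx, wE X ≠ 0 := by
    intro X hX
    obtain ⟨a, ha⟩ := Multiset.card_pos_iff_exists_mem.1 (by rw [hX.2]; exact one_pos)
    have hsep : X.charpoly.Separable := K2E3CharpolyRootsPerturbation.separable_of_discr_ne_zero (Matrix.charpoly_monic X)
      (by rw [Matrix.charpoly_natDegree_eq_dim, Fintype.card_fin]; norm_num) hX.1
    have hroot : X.charpoly.IsRoot a := (mem_roots (Matrix.charpoly_monic X).ne_zero).1 ha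
    have hder : X.charpoly.derivative.eval a ≠ 0 := hsep.eval₂_derivative_ne_zero (RingHom.id F) hroot
    have hpos : (((normAbs F (X.charpoly.derivative.eval a))⁻¹ : ℝ≥0) : ℝ≥0∞) ≠ 0 :=
      ENNReal.coe_ne_zero.2 (inv_ne_zero ((map_ne_zero (normAbs F)).2 hder))
    exact fun h0 => (mul_ne_zero hC0 hpos) (le_zero_iff.1 ((hwE_ge X a hX.1 ha).trans h0.le))
  -- the test function
  set h : Matrix (Fin 3) (Fin 3) F → ℝ≥0∞ := fun X => S.indicator (fun X => Mx.indicator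
    (fun Y => (wE Y)⁻¹ * ((normAbs F Y.charpoly.discr : ℝ≥0∞)) ^ (-σ)) X) X with hh
  have hhapp : ∀ X, h X = S.indicator (fun X => Mx.indicator (fun Y => (wE Y)⁻¹ * ((normAbs F Y.charpoly.discr : ℝ≥0∞)) ^ (-σ)) X) X := fun _ => rfl
  have hhm : Measurable h := ((hwEm.inv.mul (hnd.pow_const _)).indicator hMxm).indicator hSm
  -- (i) the integral in question is `∫ h · w`
  have hRHS : ∫⁻ X in S, Mx.indicator (fun Y => ((normAbs F Y.charpoly.discr : ℝ≥0∞)) ^ (-(1 / 2 + ε))) X ∂μ𝔤 = ∫⁻ X, h X * wE X ∂μ𝔤 := by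
    rw [← lintegral_indicator hSm]
    refine lintegral_congr fun X => ?_
    rw [hhapp]
    by_cases hXS : X ∈ S
    · by_cases hX : X ∈ Mx
      · rw [indicator_of_mem hXS, indicator_of_mem hX, indicator_of_mem hXS, indicator_of_mem hX, ← hσ, mul_comm ((wE X)⁻¹) _, mul_assoc,
          ENNReal.inv_mul_cancel (hwE_ne X hX) (hwE_top X), mul_one]
      · rw [indicator_of_mem hXS, indicator_of_notMem hX, indicator_of_mem hXS, indicator_of_notMem hX, zero_mul]
    · rw [indicator_of_notMem hXS, indicator_of_notMem hXS, zero_mul]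
  rw [hRHS, show (∫⁻ X, h X * wE X ∂μ𝔤) = ∫⁻ k : ↥(glInt 3 F), ∫⁻ r : Fin 7 → F,
      h (((k : GL (Fin 3) F) : Matrix (Fin 3) (Fin 3) F) * !![r 0, r 1, r 2; r 3, r 4, r 5; 0, 0, r 6] *
        ((((k : GL (Fin 3) F))⁻¹ : GL (Fin 3) F) : Matrix (Fin 3) (Fin 3) F)) ∂(Measure.pi fun _ : Fin 7 => dx) ∂κ from (hId h hhm).symm]
  -- (ii) the box and the two affine weights
  obtain ⟨m, hm⟩ := exists_forall_conj_parabolic_mem_imp (F := F) hS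
  set B : Set F := primePowBall F (-(m : ℤ)) with hB
  have hBm : MeasurableSet B := measurableSet_primePowBall _
  set R : Set (Fin 7 → F) := Set.pi univ fun _ => B with hR
  have hRm : MeasurableSet R := MeasurableSet.univ_pi fun _ => hBm
  set F1 : (Fin 7 → F) → ℝ≥0∞ := fun r => ((normAbs F ((r 0 - r 4) ^ 2 + 4 * r 3 * r 1) : ℝ≥0∞)) ^ (-s₁) with hF1
  set F2 : (Fin 7 → F) → ℝ≥0∞ := fun r => ((normAbs F ((r 6 - r 0) * (r 6 - r 4) + (-1) * r 3 * r 1) : ℝ≥0∞)) ^ (-s₂) with hF2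
  have hc1m : Measurable fun r : Fin 7 → F => (r 0 - r 4) ^ 2 := ((measurable_pi_apply 0).sub (measurable_pi_apply 4)).pow_const 2
  have hc2m : Measurable fun r : Fin 7 → F => (r 6 - r 0) * (r 6 - r 4) :=
    ((measurable_pi_apply 6).sub (measurable_pi_apply 0)).mul ((measurable_pi_apply 6).sub (measurable_pi_apply 4))
  have hF1m : Measurable F1 :=
    (measurable_normAbs.comp (hc1m.add ((measurable_const.mul (measurable_pi_apply 3)).mul (measurable_pi_apply 1)))).coe_nnreal_ennreal.pow_const _
  have hF2m : Measurable F2 :=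
    (measurable_normAbs.comp (hc2m.add ((measurable_const.mul (measurable_pi_apply 3)).mul (measurable_pi_apply 1)))).coe_nnreal_ennreal.pow_const _
  -- (iii) the pointwise bound on the slice
  have hpt : ∀ (k : ↥(glInt 3 F)) (r : Fin 7 → F),
      h (((k : GL (Fin 3) F) : Matrix (Fin 3) (Fin 3) F) * !![r 0, r 1, r 2; r 3, r 4, r 5; 0, 0, r 6] *
        ((((k : GL (Fin 3) F))⁻¹ : GL (Fin 3) F) : Matrix (Fin 3) (Fin 3) F)) ≤ C⁻¹ * R.indicator (fun r => F1 r + F2 r) r := by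
    intro k r
    set Y : Matrix (Fin 3) (Fin 3) F := ((k : GL (Fin 3) F) : Matrix (Fin 3) (Fin 3) F) * !![r 0, r 1, r 2; r 3, r 4, r 5; 0, 0, r 6] *
        ((((k : GL (Fin 3) F))⁻¹ : GL (Fin 3) F) : Matrix (Fin 3) (Fin 3) F) with hY
    by_cases hYS : Y ∈ S
    · by_cases hYM : Y ∈ Mx
      · have hrR : r ∈ R := Set.mem_univ_pi.2 fun i => hm k r hYS i
        rw [hhapp, indicator_of_mem hYS, indicator_of_mem hYM, indicator_of_mem hrR]
        -- invariants of `Y = Ad(k) P(r)`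
        have hchar : Y.charpoly = ((!![r 0, r 1, r 2; r 3, r 4, r 5; 0, 0, r 6] : Matrix (Fin 3) (Fin 3) F)).charpoly := by
          rw [hY]; exact K2E3GL3OrbitChartDeriv.charpoly_conj_units _ _
        set a : ℝ≥0 := normAbs F ((r 6 - r 0) * (r 6 - r 4) - r 1 * r 3) with ha
        set b : ℝ≥0 := normAbs F ((r 0 - r 4) ^ 2 + 4 * r 3 * r 1) with hb
        have hdisc : normAbs F Y.charpoly.discr = a ^ 2 * b := by
          rw [hchar, discr_charpoly_parabolic, map_mul, map_pow]
        have hD : Y.charpoly.discr ≠ 0 := hYM.1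
        have hab : a ^ 2 * b ≠ 0 := by rw [← hdisc]; exact (map_ne_zero (normAbs F)).2 hD
        have ha0 : a ≠ 0 := fun h0 => hab (by rw [h0, zero_pow two_ne_zero, zero_mul])
        have hb0 : b ≠ 0 := fun h0 => hab (by rw [h0, mul_zero])
        have ha0' : (a : ℝ≥0∞) ≠ 0 := ENNReal.coe_ne_zero.2 ha0
        have hroots : r 6 ∈ Y.charpoly.roots := by
          rw [hchar]
          exact (mem_roots (Matrix.charpoly_monic _).ne_zero).2 (K2E3GL3ParabolicSliceDensityLocal.isRoot_charpoly_parabolic r)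
        have hder : normAbs F (Y.charpoly.derivative.eval (r 6)) = a := by rw [hchar, derivative_charpoly_parabolic_eval]
        -- `w(Y)⁻¹ ≤ C⁻¹ ‖χ_A(r₆)‖`
        have hinv : (wE Y)⁻¹ ≤ C⁻¹ * (a : ℝ≥0∞) := by
          have hge := hwE_ge Y (r 6) hD hroots
          rw [hder] at hge
          calc (wE Y)⁻¹ ≤ (C * (((a⁻¹ : ℝ≥0)) : ℝ≥0∞))⁻¹ := ENNReal.inv_le_inv' hge
            _ = C⁻¹ * (a : ℝ≥0∞) := by rw [ENNReal.mul_inv (Or.inl hC0) (Or.inl hCt), ENNReal.coe_inv ha0, inv_inv]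
        -- `‖disc‖^{-σ} = ‖χ_A(r₆)‖^{-2σ} ‖disc χ_A‖^{-σ}`
        have hpow : ((normAbs F Y.charpoly.discr : ℝ≥0∞)) ^ (-σ) = (a : ℝ≥0∞) ^ ((2 : ℝ) * (-σ)) * (b : ℝ≥0∞) ^ (-σ) := by
          rw [hdisc, ENNReal.coe_mul, ENNReal.coe_pow, ENNReal.mul_rpow_of_ne_top (ENNReal.pow_ne_top ENNReal.coe_ne_top) ENNReal.coe_ne_top,
            ← ENNReal.rpow_two, ← ENNReal.rpow_mul]
        have hexp : (1 : ℝ) + 2 * (-σ) = -(2 * ε) := by rw [hσ]; ring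
        calc (wE Y)⁻¹ * ((normAbs F Y.charpoly.discr : ℝ≥0∞)) ^ (-σ)
            ≤ (C⁻¹ * (a : ℝ≥0∞)) * ((a : ℝ≥0∞) ^ ((2 : ℝ) * (-σ)) * (b : ℝ≥0∞) ^ (-σ)) := by rw [hpow]; exact mul_le_mul' hinv le_rfl
          _ = C⁻¹ * (((a : ℝ≥0∞) ^ (1 : ℝ) * (a : ℝ≥0∞) ^ ((2 : ℝ) * (-σ))) * (b : ℝ≥0∞) ^ (-σ)) := by rw [ENNReal.rpow_one]; ring
          _ = C⁻¹ * ((b : ℝ≥0∞) ^ (-σ) * (a : ℝ≥0∞) ^ (-(2 * ε))) := by rw [← ENNReal.rpow_add _ _ ha0' ENNReal.coe_ne_top, hexp, mul_comm ((a : ℝ≥0∞) ^ _)]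
          _ ≤ C⁻¹ * (((b : ℝ≥0∞) ^ (-σ)) ^ (4 / 3 : ℝ) + ((a : ℝ≥0∞) ^ (-(2 * ε))) ^ (4 : ℝ)) := mul_le_mul' le_rfl (mul_le_rpow_add_rpow _ _)
          _ = C⁻¹ * (F1 r + F2 r) := by
              rw [← ENNReal.rpow_mul, ← ENNReal.rpow_mul, hF1, hF2]
              simp only
              rw [hb, ha, show (r 6 - r 0) * (r 6 - r 4) + (-1) * r 3 * r 1 = (r 6 - r 0) * (r 6 - r 4) - r 1 * r 3 by ring,
                show -σ * (4 / 3 : ℝ) = -s₁ by rw [hσ, hs₁]; ring, show -(2 * ε) * (4 : ℝ) = -s₂ by rw [hs₂]; ring]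
      · rw [hhapp, indicator_of_mem hYS, indicator_of_notMem hYM]; exact zero_le
    · rw [hhapp, indicator_of_notMem hYS]; exact zero_le
  -- (iv) integrate the bound: the two box integrals are finite by ★ M3a
  have h40 : (4 : F) ≠ 0 := by
    rw [show (4 : F) = 2 * 2 by norm_num]; exact mul_ne_zero h2 h2
  have h10 : (1 : Fin 7) ≠ 0 := by decide
  have h14 : (1 : Fin 7) ≠ 4 := by decide
  have h16 : (1 : Fin 7) ≠ 6 := by decide
  have hI1 : ∫⁻ r, F1 r ∂(Measure.pi fun _ : Fin 7 => dx.restrict B) < ∞ := by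
    have h := lintegral_pi_restrict_normAbs_affine_rpow_neg_lt_top dx (-(m : ℤ)) hs₁0 hs₁1 h40 (c := fun r : Fin 7 → F => (r 0 - r 4) ^ 2) hc1m
      (fun r t => by simp only [Function.update_of_ne h10.symm, Function.update_of_ne (show (4 : Fin 7) ≠ 1 by decide)])
    exact h
  have hI2 : ∫⁻ r, F2 r ∂(Measure.pi fun _ : Fin 7 => dx.restrict B) < ∞ := by
    have h := lintegral_pi_restrict_normAbs_affine_rpow_neg_lt_top dx (-(m : ℤ)) hs₂0 hs₂1 (neg_ne_zero.2 (one_ne_zero' F))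
      (c := fun r : Fin 7 → F => (r 6 - r 0) * (r 6 - r 4)) hc2m
      (fun r t => by simp only [Function.update_of_ne (show (6 : Fin 7) ≠ 1 by decide), Function.update_of_ne (show (0 : Fin 7) ≠ 1 by decide),
        Function.update_of_ne (show (4 : Fin 7) ≠ 1 by decide)])
    exact h
  have hbox : ∫⁻ r : Fin 7 → F, R.indicator (fun r => F1 r + F2 r) r ∂(Measure.pi fun _ : Fin 7 => dx) < ∞ := by
    rw [lintegral_indicator hRm, hR, Measure.restrict_pi_pi, lintegral_add_left hF1m]
    exact ENNReal.add_lt_top.2 ⟨hI1, hI2⟩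
  calc ∫⁻ k : ↥(glInt 3 F), ∫⁻ r : Fin 7 → F,
        h (((k : GL (Fin 3) F) : Matrix (Fin 3) (Fin 3) F) * !![r 0, r 1, r 2; r 3, r 4, r 5; 0, 0, r 6] *
          ((((k : GL (Fin 3) F))⁻¹ : GL (Fin 3) F) : Matrix (Fin 3) (Fin 3) F)) ∂(Measure.pi fun _ : Fin 7 => dx) ∂κ
      ≤ ∫⁻ _k : ↥(glInt 3 F), ∫⁻ r : Fin 7 → F, C⁻¹ * R.indicator (fun r => F1 r + F2 r) r ∂(Measure.pi fun _ : Fin 7 => dx) ∂κ :=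
        lintegral_mono fun k => lintegral_mono fun r => hpt k r
    _ = (C⁻¹ * ∫⁻ r : Fin 7 → F, R.indicator (fun r => F1 r + F2 r) r ∂(Measure.pi fun _ : Fin 7 => dx)) * κ univ := by
        rw [lintegral_const, lintegral_const_mul' _ _ (ENNReal.inv_ne_top.2 hC0)]
    _ < ∞ := ENNReal.mul_lt_top (ENNReal.mul_lt_top (ENNReal.inv_lt_top.2 (pos_iff_ne_zero.2 hC0)) hbox) (measure_lt_top κ _)

/-- **T15-log, MIXED HALF (power form): `X ↦ 1[disc χ_X ≠ 0 ∧ χ_X has exactly one root in F] · ‖disc χ_X‖_F^{-(1/2+ε)}` IS LOCALLY INTEGRABLE ON `𝔤𝔩₃(F)`**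
for every `0 < ε < 1/8` and every additive Haar measure `μ𝔤` (`2 ≠ 0` in `F`) — Harish-Chandra's Theorem 15 for the mixed Cartan `E× × F×`, on the Lie algebra.
[cite: HarishChandra1970, Part VII §3 Thm. 15 p. 72, Part V §6] [cite: HarishChandra1999AdmissibleDistributions, §15] -/
theorem locallyIntegrable_indicator_mixed_rpow_neg (h2 : (2 : F) ≠ 0) (μ𝔤 : Measure (Matrix (Fin 3) (Fin 3) F)) [μ𝔤.IsAddHaarMeasure]
    {ε : ℝ} (hε0 : 0 < ε) (hε : ε < 1 / 8) :
    LocallyIntegrable (fun X : Matrix (Fin 3) (Fin 3) F =>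
      {Y : Matrix (Fin 3) (Fin 3) F | Y.charpoly.discr ≠ 0 ∧ Y.charpoly.roots.card = 1}.indicator
        (fun Y => ((normAbs F Y.charpoly.discr : ℝ)) ^ (-(1 / 2 + ε))) X) μ𝔤 := by
  haveI : T2Space F := (isLocalField F).toT2Space
  haveI : LocallyCompactSpace F := (isLocalField F).toLocallyCompactSpace
  haveI : IsTopologicalRing F := inferInstance
  haveI : T2Space (Matrix (Fin 3) (Fin 3) F) := inferInstanceAs (T2Space (Fin 3 → Fin 3 → F))
  haveI : LocallyCompactSpace (Matrix (Fin 3) (Fin 3) F) := Pi.locallyCompactSpace_of_finite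
  letI : MeasurableSpace F := borel F
  haveI : BorelSpace F := ⟨rfl⟩
  set 𝔤' : Set (Matrix (Fin 3) (Fin 3) F) := {Y : Matrix (Fin 3) (Fin 3) F | Y.charpoly.discr ≠ 0 ∧ Y.charpoly.roots.card = 1} with h𝔤'
  have h𝔤'm : MeasurableSet 𝔤' := (isOpen_setOf_charpoly_discr_ne_zero_and_card_roots_eq 1).measurableSet
  have hdiscm : Measurable fun Y : Matrix (Fin 3) (Fin 3) F => Y.charpoly.discr := (F0P3cStCharTSHCDGroupToLie.continuous_discr_charpoly (K := F)).measurable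
  have hm : Measurable fun X : Matrix (Fin 3) (Fin 3) F => 𝔤'.indicator (fun Y => ((normAbs F Y.charpoly.discr : ℝ)) ^ (-(1 / 2 + ε))) X :=
    (((measurable_normAbs.comp hdiscm).coe_nnreal_real).pow_const _).indicator h𝔤'm
  refine (locallyIntegrable_iff).2 fun S hS => ⟨hm.aestronglyMeasurable, ?_⟩
  show ∫⁻ X in S, ‖𝔤'.indicator (fun Y => ((normAbs F Y.charpoly.discr : ℝ)) ^ (-(1 / 2 + ε))) X‖ₑ ∂μ𝔤 < ∞
  have hpt : ∀ X, ‖𝔤'.indicator (fun Y => ((normAbs F Y.charpoly.discr : ℝ)) ^ (-(1 / 2 + ε))) X‖ₑ =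
      𝔤'.indicator (fun Y => ((normAbs F Y.charpoly.discr : ℝ≥0∞)) ^ (-(1 / 2 + ε))) X := by
    intro X
    by_cases hX : X ∈ 𝔤'
    · rw [indicator_of_mem hX, indicator_of_mem hX]
      have ht : 0 < (normAbs F X.charpoly.discr : ℝ) := NNReal.coe_pos.2 (pos_iff_ne_zero.2 ((map_ne_zero (normAbs F)).2 hX.1))
      rw [Real.enorm_eq_ofReal (Real.rpow_nonneg ht.le _), ← ENNReal.ofReal_rpow_of_pos ht, ENNReal.ofReal_coe_nnreal]
    · rw [indicator_of_notMem hX, indicator_of_notMem hX, enorm_zero]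
  simp_rw [hpt]
  exact setLIntegral_indicator_mixed_rpow_neg_lt_top h2 μ𝔤 hS hε0 hε

end Main

end Summit.HodgeConjecture.HodgeConjecture.Cruxes.H413.K2E3GL3MixedDiscriminantLocIntegrable

end
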